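import Mathlib
import Literature.NumberTheory.LFunctions.Zhang2022.Section14Eq148Leg1Twisted
import Literature.NumberTheory.LFunctions.Zhang2022.Section14Eq146W
import HarnessLib

/-!
# Zhang (2022) §14 (14.6): the small-conductor leg at the modulus `D₂k` (`r < D³`), β-uniform

Topic `Literature/NumberTheory/LFunctions/Zhang2022` (Landau–Siegel audit tree; verdict-neutral).
Y. Zhang, *Discrete mean estimates and the Landau–Siegel zero*, arXiv:2211.02515v1 (2022)
[Zhang2022LandauSiegel] — **an unrefereed manuscript under adjudication; nothing here asserts or denies
its Theorems 1–2 or Proposition 14.1.** ZHANG-L discharge lane, WP14, helper under the leaf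
`Skeleton.Prop141` (node `Z22:(14.6)`, GAP rows G-adj2-4 / G-L3t7-1; WP14-PLAN v1.1 §2.1 node
**leg1₂**). The printed proof of (14.6) is one sentence (p. 79, tex L3966–L3969: "The proof of (14.6)
is analogous … the main terms involved in the proof of (14.5) do not appear"); after the re-indexing
of the non-principal characters `θ (mod D₂k)` by conductor (`Typed.Sec14.nonprincipal₂_le_reindex`)
and the reduction `Typed.Sec14.eq146W_of_legs` (both in tree), what remains of (14.6) — at general
`β`, as Proposition 14.1 needs it ("the general case is almost identical", p. 76) — are the two
(14.8)-type legs at the modulus `D₂k`. This THEOREM-ONLY file proves the FIRST of them ("for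
`1 < r < D³` we use the Mellin transform, Lemma 5.4 (i) and Lemma 5.6", p. 79, tex L3960–L3962) as
the `N = D₂` instance of the lane's β-twisted small-conductor engine (WP14-PLAN v1.1 §2.1):

* `leg1₂_holds` — **the hypothesis `hleg1` of `Typed.Sec14.eq146W_of_legs` / `eq146_of_legsW`,
  VERBATIM**: for every `B` there are `c > 0`, `C` with, for all large `D` under (A), all `‖β‖ < 5α`,
  all `κ*, a*` with (14.1)–(14.2), every `D = D₁D₂` with `D₁ > 1`:
  `Σ_{d≤2P₄} d⁻¹ Σ_{2≤r≤2D₂P₄, r<D³} Σ_{h<P/r, D₂/(D₂,r)∣h} D₂/(φ(hr)h√r) Σ*_{θ' mod r, θ'↑≠χ↑}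
   ‖Σ_{(l,h)=1} κ*(D₁dl)θ'(l)Σ_{p∼P} χθ̄'(p)(pt₀)^β Δ(l/(phr))‖ ≤ C·P²·D^{−c}` (`c = C = 1`):
  per character the β-twisted small-conductor engine of the lane (`smallConductor_tsum_le_wt`,
  `Section14Eq148Leg1Twisted`, WP14 p7: Mellin at `σ = 1` + Lemma 5.4 (i) + the β-twisted Lemma 5.6
  `Skeleton.lemma56_chi_mul_inv_beta`) at `d ↦ D₁d`, `A = 13`, `d(D₁d) ≤ d(D₁)d(d) ≤ D·d(d)`;
  then `#θ' ≤ φ(r) ≤ r`, `hr/φ(hr) ≤ 4𝓛¹⁸`, `D₂ ≤ D`, `Σ_h 1/h ≤ 3𝓛⁹`, `#{r < D³} ≤ D³`,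
  `Σ_d d(d)⁴/d ≤ (2𝓛⁹)¹⁶`, `12·2¹⁶·C·𝓛¹⁷¹·D¹¹·D⁻¹³ ≤ D⁻¹` — the (14.6)-twin of `eq148leg1_holds`;
* `eq146W_of_leg2₂`, `eq146_of_leg2₂` — (14.6)ᵂ resp. `Typed.Sec14.Eq146` from the REMAINING leg
  (`r ≥ D³`, large sieve) alone, by `eq146W_of_legs` / `eq146_of_legsW`.

No new definitions, no new named facts; every analytic input is a tree theorem.

## References

* Y. Zhang, arXiv:2211.02515v1 (2022), §14 (14.6) p. 78 and its proof sentence p. 79 (tex L3915,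
  L3960–L3969); Prop. 14.1 p. 76; §5 Lemmas 5.3, 5.4, 5.6. [cite: Zhang2022LandauSiegel, §14 (14.6) pp.78–79]
-/

noncomputable section

open Complex Real

namespace Literature.NumberTheory.LFunctions.Zhang2022.Typed.Sec14

open Skeleton DirichletCharacter

/-! ## Small helpers -/

/-- `d(mn) ≤ d(m)·d(n)` (local copy of the lane's helper). [folklore] -/
private theorem card_divisors_mul_le₂ (m n : ℕ) :
    (m * n).divisors.card ≤ m.divisors.card * n.divisors.card := by
  rw [Nat.divisors_mul]
  exact Finset.card_mul_le

/-- The harmonic bound on `Ico`: `Σ_{1 ≤ h < N} 1/h ≤ 1 + log N`. [folklore] -/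
private theorem sum_Ico_one_div_le₂ (N : ℕ) : ∑ h ∈ Finset.Ico 1 N, (1 : ℝ) / h ≤ 1 + Real.log N := by
  calc ∑ h ∈ Finset.Ico 1 N, (1 : ℝ) / h ≤ ∑ h ∈ Finset.Icc 1 N, (1 : ℝ) / h :=
        Finset.sum_le_sum_of_subset_of_nonneg
          (fun h hh => by
            rw [Finset.mem_Ico] at hh; rw [Finset.mem_Icc]; omega)
          (fun _ _ _ => by positivity)
    _ ≤ 1 + Real.log N := sum_Icc_one_div_le_one_add_log N

/-! ## The small-conductor leg of (14.6) at the modulus `D₂k`: the aggregation -/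

set_option maxHeartbeats 400000 in
/-- **The first leg of (14.6) at the modulus `D₂k`, β-uniform** — the hypothesis `hleg1` of
`Typed.Sec14.eq146W_of_legs` / `eq146_of_legsW`, verbatim: for every `B` there are `c > 0`, `C`
(`c = C = 1`) such that for all large `D` under (A), all `‖β‖ < 5α`, all `κ*, a*` with (14.1)–(14.2) and
every factorisation `D = D₁D₂` with `D₁ > 1`, the `r < D³` part of the re-indexed non-principal
majorant of `Σ_{p∼P} χ(p)(pt₀)^β 𝒮(D₁,D₂;p)` (prefactor `D₂/(φ(hr)h√r)`, `D₂/(D₂,r) ∣ h`,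
coefficients `κ*(D₁dl)`, primitive `θ' (mod r)` with `θ' ≠ χ`) is `≤ C·P²·D^{−c}` ("for `1 < r < D³`
we use the Mellin transform, Lemma 5.4 (i) and Lemma 5.6 … The proof of (14.6) is analogous", p. 79).
Per character: `smallConductor_tsum_le_wt` (`Section14Eq148Leg1Twisted`) at `d ↦ D₁d` with `A = 13` (`|θ'(l)| ≤ 1`,
`d(D₁d) ≤ d(D₁)d(d) ≤ D·d(d)`); then `#{θ' (mod r)} ≤ φ(r) ≤ r`, `√r ≥ 1`, `hr/φ(hr) ≤ 4𝓛¹⁸`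
(`hr ≤ P`), `D₂ ≤ D`, `Σ_{h<P/r} 1/h ≤ 3𝓛⁹`, `#{r < D³} ≤ D³`, `Σ_{d ≤ 2P₄} d(d)⁴/d ≤ (2𝓛⁹)¹⁶`, and
`12·2¹⁶·C·𝓛¹⁷¹·D¹¹·D⁻¹³ ≤ D⁻¹` for `D` large — the (14.6)-twin of `eq148leg1_holds`.
[cite: Zhang2022LandauSiegel, §14 (14.6) proof p.79, tex L3960–L3969; (14.8) p.79; Prop. 14.1 p.76] -/
theorem leg1₂_holds :
    ∀ B : ℝ, ∃ c : ℝ, 0 < c ∧ ∃ C : ℝ, ForAllLarge fun D _ χ => AssumptionA D χ →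
      ∀ β : ℂ, ‖β‖ < 5 * alpha D → ∀ κs as : ℕ → ℂ, Eq141 B κs → Eq142 D B as →
        ∀ D₁ D₂ : ℕ, D₁ * D₂ = D → 1 < D₁ →
          ∑ d ∈ Finset.Icc 1 ⌊2 * P4 D⌋₊, (d : ℝ)⁻¹ *
            ∑ r ∈ (Finset.Icc 2 ⌊2 * (D₂ : ℝ) * P4 D⌋₊).filter (fun r => r < D ^ 3),
              ∑ h ∈ (Finset.Ico 1 ⌈bigP D / r⌉₊).filter (fun h => D₂ / Nat.gcd D₂ r ∣ h),
                (D₂ : ℝ) / ((Nat.totient (h * r) : ℝ) * h * Real.sqrt r) *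
                  ∑ θ' ∈ finsetOf {θ' : DirichletCharacter ℂ r | θ'.IsPrimitive ∧
                      changeLevel (dvd_mul_left r D) θ' ≠ changeLevel (dvd_mul_right D r) χ},
                    ‖∑' l : ℕ, if Nat.Coprime l h then κs (D₁ * d * l) * θ' (l : ZMod r) *
                        ∑ p ∈ primeWindow D, χ (p : ZMod D) * θ'⁻¹ (p : ZMod r) * wt D β p *
                        DeltaW D ((l : ℝ) / ((p : ℝ) * h * r)) else 0‖
          ≤ C * bigP D ^ 2 * (D : ℝ) ^ (-c) := by
  classical
  intro B
  obtain ⟨C₀, hC₀0, DS, hS⟩ := smallConductor_tsum_le_wt 13 B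
  obtain ⟨DP4, hP4⟩ := exists_two_mul_P4_le_bigP
  obtain ⟨Dℓ, hℓ2⟩ := exists_nat_forall_le_ell 2
  obtain ⟨Dabs, habs⟩ := exists_mul_ell_pow_le 171 (show (0 : ℝ) ≤ 12 * 2 ^ 16 * C₀ by positivity)
  refine ⟨1, one_pos, 1, DS + DP4 + Dℓ + Dabs + 3,
    fun D _ χ hD hq hp hA β hβ κs as hκ _ D₁ D₂ hD₁₂ hD₁ => ?_⟩
  have hD3 : 3 ≤ D := by omega
  have hDne : D ≠ 0 := by omega
  have hD0 : (0 : ℝ) < D := by exact_mod_cast (show 0 < D by omega)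
  have hD1 : (1 : ℝ) ≤ D := by exact_mod_cast (show 1 ≤ D by omega)
  have hℓ2' : 2 ≤ ell D := hℓ2 D (by omega)
  have hℓ1 : 1 ≤ ell D := by linarith
  have hP0 : 0 < bigP D := Real.exp_pos _
  have hP1 : 1 ≤ bigP D := Real.one_le_exp (by positivity)
  have hlogP : Real.log (bigP D) = ell D ^ 9 := by rw [bigP, Real.log_exp]
  have h9 : (2 : ℝ) ≤ ell D ^ 9 := le_trans hℓ2' (le_self_pow₀ hℓ1 (by norm_num))
  have hlog2 : Real.log 2 ≤ 1 := by
    have := Real.log_le_sub_one_of_pos (show (0 : ℝ) < 2 by norm_num); linarith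
  -- the factorisation `D = D₁D₂`: `1 ≤ D₂ ≤ D`, `D₁ ≤ D`
  have hD₂1 : 1 ≤ D₂ := Nat.pos_of_ne_zero fun h => by subst h; simp at hD₁₂; exact hDne hD₁₂.symm
  have hD₂D : (D₂ : ℝ) ≤ D := by
    have : D₂ ≤ D := by
      calc D₂ = 1 * D₂ := (one_mul _).symm
        _ ≤ D₁ * D₂ := Nat.mul_le_mul_right _ (by omega)
        _ = D := hD₁₂
    exact_mod_cast this
  have hD₁D : (D₁ : ℝ) ≤ D := by
    have : D₁ ≤ D := by
      calc D₁ = D₁ * 1 := (mul_one _).symm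
        _ ≤ D₁ * D₂ := Nat.mul_le_mul_left _ hD₂1
        _ = D := hD₁₂
    exact_mod_cast this
  have hD₂0 : (0 : ℝ) ≤ (D₂ : ℝ) := Nat.cast_nonneg _
  set L : ℝ := ell D with hL
  set P : ℝ := bigP D with hPdef
  set Sr : Finset ℕ := (Finset.Icc 2 ⌊2 * (D₂ : ℝ) * P4 D⌋₊).filter (fun r => r < D ^ 3) with hSr
  -- the per-character bound, as a function of `(d, h, r)`
  set BND : ℕ → ℕ → ℕ → ℝ := fun d h r =>
    C₀ * ((D₁ * d).divisors.card : ℝ) ^ 4 * ((h * r : ℕ) : ℝ) * P ^ 2 * (D : ℝ) ^ (-((13 : ℕ) : ℝ))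
    with hBND
  have hBND0 : ∀ d h r, 0 ≤ BND d h r := fun d h r => by simp only [hBND]; positivity
  -- Step 1: one character
  have hchar : ∀ (d r h : ℕ) (θ : DirichletCharacter ℂ r), r ∈ Sr →
      h ∈ (Finset.Ico 1 ⌈bigP D / r⌉₊).filter (fun h => D₂ / Nat.gcd D₂ r ∣ h) →
      θ ∈ finsetOf {θ : DirichletCharacter ℂ r | θ.IsPrimitive ∧
          changeLevel (dvd_mul_left r D) θ ≠ changeLevel (dvd_mul_right D r) χ} →
      ‖∑' l : ℕ, if Nat.Coprime l h then
          κs (D₁ * d * l) * θ (l : ZMod r) *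
            ∑ p ∈ primeWindow D, χ (p : ZMod D) * θ⁻¹ (p : ZMod r) * wt D β p *
              DeltaW D ((l : ℝ) / ((p : ℝ) * h * r)) else 0‖ ≤ BND d h r := by
    intro d r h θ hr hh hθ
    obtain ⟨hr1, hr3⟩ := Finset.mem_filter.mp hr
    have hr2 : 2 ≤ r := (Finset.mem_Icc.mp hr1).1
    obtain ⟨hh1, -⟩ := Finset.mem_filter.mp hh
    obtain ⟨hh0, hhP⟩ := Finset.mem_Ico.mp hh1
    obtain ⟨hθp, hne⟩ := mem_of_mem_finsetOf hθ
    have hr0 : (0 : ℝ) < r := by exact_mod_cast (show 0 < r by omega)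
    have hrD : (r : ℝ) < (D : ℝ) ^ 3 := by exact_mod_cast hr3
    have hhr : ((h * r : ℕ) : ℝ) ≤ bigP D := by
      have h1 : (h : ℝ) < bigP D / r := Nat.lt_ceil.mp hhP
      rw [lt_div_iff₀ hr0] at h1
      push_cast; exact h1.le
    have hSeq : ∀ l : ℕ, (∑ p ∈ primeWindow D, χ (p : ZMod D) * θ⁻¹ (p : ZMod r) * wt D β p *
        DeltaW D ((l : ℝ) / ((p : ℝ) * h * r))) =
        ∑ p ∈ primeWindow D, χ (p : ZMod D) * θ⁻¹ (p : ZMod r) * wt D β p *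
          DeltaW D ((l : ℝ) / ((p : ℝ) * ((h * r : ℕ) : ℝ))) := by
      intro l
      refine Finset.sum_congr rfl fun p _ => ?_
      simp only [Nat.cast_mul, mul_assoc]
    refine hS D χ (by omega) hq hp hA β hβ.le κs hκ (D₁ * d) r h θ (by omega) hrD (by omega) hhr hθp
      hne _ ?_
    intro l
    rw [← hSeq l]
    split_ifs with hc
    · rw [norm_mul, norm_mul]
      calc ‖κs (D₁ * d * l)‖ * ‖θ (l : ZMod r)‖ * _ ≤ ‖κs (D₁ * d * l)‖ * 1 * _ := by
            gcongr; exact DirichletCharacter.norm_le_one _ _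
        _ = _ := by rw [mul_one]
    · rw [norm_zero]; positivity
  -- Step 2: the sum over the characters at `(d, r, h)` is `≤ r · BND`
  have hθsum : ∀ (d r h : ℕ), r ∈ Sr →
      h ∈ (Finset.Ico 1 ⌈bigP D / r⌉₊).filter (fun h => D₂ / Nat.gcd D₂ r ∣ h) →
      (∑ θ ∈ finsetOf {θ : DirichletCharacter ℂ r | θ.IsPrimitive ∧
          changeLevel (dvd_mul_left r D) θ ≠ changeLevel (dvd_mul_right D r) χ},
        ‖∑' l : ℕ, if Nat.Coprime l h then
            κs (D₁ * d * l) * θ (l : ZMod r) *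
              ∑ p ∈ primeWindow D, χ (p : ZMod D) * θ⁻¹ (p : ZMod r) * wt D β p *
                DeltaW D ((l : ℝ) / ((p : ℝ) * h * r)) else 0‖) ≤ (r : ℝ) * BND d h r := by
    intro d r h hr hh
    have hr2 : 2 ≤ r := (Finset.mem_Icc.mp (Finset.mem_filter.mp hr).1).1
    haveI : NeZero r := ⟨by omega⟩
    set T := finsetOf {θ : DirichletCharacter ℂ r | θ.IsPrimitive ∧
          changeLevel (dvd_mul_left r D) θ ≠ changeLevel (dvd_mul_right D r) χ} with hT
    have h1 := Finset.sum_le_card_nsmul T _ (BND d h r) (fun θ hθ => hchar d r h θ hr hh hθ)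
    rw [nsmul_eq_mul] at h1
    refine h1.trans (mul_le_mul_of_nonneg_right ?_ (hBND0 d h r))
    have hcard : T.card ≤ Fintype.card (DirichletCharacter ℂ r) := Finset.card_le_univ _
    have htot : Fintype.card (DirichletCharacter ℂ r) = r.totient := by
      rw [← Nat.card_eq_fintype_card, DirichletCharacter.card_eq_totient_of_hasEnoughRootsOfUnity ℂ r]
    calc (T.card : ℝ) ≤ (Fintype.card (DirichletCharacter ℂ r) : ℝ) := by exact_mod_cast hcard
      _ = (r.totient : ℝ) := by rw [htot]
      _ ≤ r := by exact_mod_cast Nat.totient_le r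
  -- Step 3: the weighted `(d, r, h)` term is `≤ M · d(d)⁴ · (1/h)`
  set M : ℝ := 4 * L ^ 18 * C₀ * P ^ 2 * (D : ℝ) ^ (-((13 : ℕ) : ℝ)) * (D : ℝ) * (D : ℝ) ^ 3 *
    (D : ℝ) ^ 4 with hM
  have hM0 : 0 ≤ M := by positivity
  have hdiv : ∀ d : ℕ, ((D₁ * d).divisors.card : ℝ) ^ 4 ≤ (D : ℝ) ^ 4 * (d.divisors.card : ℝ) ^ 4 := by
    intro d
    have h1 : ((D₁ * d).divisors.card : ℝ) ≤ (D₁.divisors.card : ℝ) * d.divisors.card := by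
      exact_mod_cast card_divisors_mul_le₂ D₁ d
    have h2 : (D₁.divisors.card : ℝ) ≤ D :=
      le_trans (by exact_mod_cast Nat.card_divisors_le_self D₁) hD₁D
    calc ((D₁ * d).divisors.card : ℝ) ^ 4 ≤ ((D₁.divisors.card : ℝ) * d.divisors.card) ^ 4 :=
          pow_le_pow_left₀ (Nat.cast_nonneg _) h1 4
      _ ≤ ((D : ℝ) * d.divisors.card) ^ 4 :=
          pow_le_pow_left₀ (by positivity) (mul_le_mul_of_nonneg_right h2 (Nat.cast_nonneg _)) 4
      _ = (D : ℝ) ^ 4 * (d.divisors.card : ℝ) ^ 4 := mul_pow _ _ _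
  have hterm : ∀ (d r h : ℕ), r ∈ Sr →
      h ∈ (Finset.Ico 1 ⌈bigP D / r⌉₊).filter (fun h => D₂ / Nat.gcd D₂ r ∣ h) →
      (D₂ : ℝ) / ((Nat.totient (h * r) : ℝ) * h * Real.sqrt r) * ((r : ℝ) * BND d h r) ≤
        M * (d.divisors.card : ℝ) ^ 4 * (1 / (h : ℝ)) := by
    intro d r h hr hh
    obtain ⟨hr1, hr3⟩ := Finset.mem_filter.mp hr
    have hr2 : 2 ≤ r := (Finset.mem_Icc.mp hr1).1
    obtain ⟨hh1, -⟩ := Finset.mem_filter.mp hh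
    obtain ⟨hh0, hhP⟩ := Finset.mem_Ico.mp hh1
    have hr0 : (0 : ℝ) < r := by exact_mod_cast (show 0 < r by omega)
    have hh0' : (0 : ℝ) < h := by exact_mod_cast hh0
    have hrD : (r : ℝ) ≤ (D : ℝ) ^ 3 := by exact_mod_cast hr3.le
    have hhr0 : (0 : ℝ) < ((h * r : ℕ) : ℝ) := by exact_mod_cast Nat.mul_pos hh0 (by omega)
    have hhrP : ((h * r : ℕ) : ℝ) ≤ bigP D := by
      have h1 : (h : ℝ) < bigP D / r := Nat.lt_ceil.mp hhP
      rw [lt_div_iff₀ hr0] at h1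
      push_cast; exact h1.le
    have htot0 : (0 : ℝ) < (Nat.totient (h * r) : ℝ) := by
      exact_mod_cast Nat.totient_pos.2 (Nat.mul_pos hh0 (by omega))
    have hsqrt1 : (1 : ℝ) ≤ Real.sqrt r := by
      rw [show (1 : ℝ) = Real.sqrt 1 from Real.sqrt_one.symm]
      exact Real.sqrt_le_sqrt (by exact_mod_cast (show 1 ≤ r by omega))
    -- `hr ≤ 4𝓛¹⁸ φ(hr)`
    have hweight : ((h * r : ℕ) : ℝ) ≤ 4 * L ^ 18 * (Nat.totient (h * r) : ℝ) := by
      have hnat := Literature.NumberTheory.Sieve.natCast_div_totient_le (h * r)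
      rw [div_le_iff₀ htot0] at hnat
      have hlog : Real.log ((h * r : ℕ) : ℝ) ≤ L ^ 9 := by
        calc Real.log ((h * r : ℕ) : ℝ) ≤ Real.log (bigP D) := Real.log_le_log hhr0 hhrP
          _ = L ^ 9 := hlogP
      have hlog0 : 0 ≤ Real.log ((h * r : ℕ) : ℝ) := Real.log_natCast_nonneg _
      have h19 : (1 : ℝ) ≤ L ^ 9 := one_le_pow₀ hℓ1
      have hsq : (1 + Real.log ((h * r : ℕ) : ℝ)) ^ 2 ≤ 4 * L ^ 18 := by
        calc (1 + Real.log ((h * r : ℕ) : ℝ)) ^ 2 ≤ (2 * L ^ 9) ^ 2 :=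
              pow_le_pow_left₀ (by linarith) (by linarith) 2
          _ = 4 * L ^ 18 := by ring
      exact hnat.trans (mul_le_mul_of_nonneg_right hsq htot0.le)
    -- the comparison, cleared of denominators
    have hden : (0 : ℝ) < (Nat.totient (h * r) : ℝ) * h * Real.sqrt r := by positivity
    rw [div_mul_eq_mul_div, div_le_iff₀ hden]
    have hcore : (r : ℝ) * ((h * r : ℕ) : ℝ) * 1 ≤
        (D : ℝ) ^ 3 * (4 * L ^ 18 * (Nat.totient (h * r) : ℝ)) * Real.sqrt r :=
      mul_le_mul (mul_le_mul hrD hweight hhr0.le (by positivity)) hsqrt1 zero_le_one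
        (by positivity)
    have hfirst : (D₂ : ℝ) * C₀ * ((D₁ * d).divisors.card : ℝ) ^ 4 * P ^ 2 *
        (D : ℝ) ^ (-((13 : ℕ) : ℝ)) ≤
        (D : ℝ) * C₀ * ((D : ℝ) ^ 4 * (d.divisors.card : ℝ) ^ 4) * P ^ 2 *
          (D : ℝ) ^ (-((13 : ℕ) : ℝ)) := by
      have h1 := hdiv d
      gcongr
    have hfac : 0 ≤ (D : ℝ) * C₀ * ((D : ℝ) ^ 4 * (d.divisors.card : ℝ) ^ 4) * P ^ 2 *
        (D : ℝ) ^ (-((13 : ℕ) : ℝ)) := by positivity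
    have hfirst0 : 0 ≤ (D₂ : ℝ) * C₀ * ((D₁ * d).divisors.card : ℝ) ^ 4 * P ^ 2 *
        (D : ℝ) ^ (-((13 : ℕ) : ℝ)) := by positivity
    have hh1' : (1 / (h : ℝ)) * ((Nat.totient (h * r) : ℝ) * h * Real.sqrt r) =
        (Nat.totient (h * r) : ℝ) * Real.sqrt r := by
      field_simp
    calc (D₂ : ℝ) * ((r : ℝ) * BND d h r)
        = ((D₂ : ℝ) * C₀ * ((D₁ * d).divisors.card : ℝ) ^ 4 * P ^ 2 * (D : ℝ) ^ (-((13 : ℕ) : ℝ))) *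
            ((r : ℝ) * ((h * r : ℕ) : ℝ) * 1) := by simp only [hBND]; ring
      _ ≤ ((D : ℝ) * C₀ * ((D : ℝ) ^ 4 * (d.divisors.card : ℝ) ^ 4) * P ^ 2 *
            (D : ℝ) ^ (-((13 : ℕ) : ℝ))) *
            ((D : ℝ) ^ 3 * (4 * L ^ 18 * (Nat.totient (h * r) : ℝ)) * Real.sqrt r) :=
          mul_le_mul hfirst hcore (by positivity) hfac
      _ = M * (d.divisors.card : ℝ) ^ 4 * ((Nat.totient (h * r) : ℝ) * Real.sqrt r) := by
          simp only [hM]; ring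
      _ = M * (d.divisors.card : ℝ) ^ 4 * (1 / (h : ℝ)) *
            ((Nat.totient (h * r) : ℝ) * h * Real.sqrt r) := by
          rw [mul_assoc (M * (d.divisors.card : ℝ) ^ 4) (1 / (h : ℝ)), hh1']
  -- Step 4: the sum over `h` at fixed `(d, r)`
  have hsumh : ∀ (d r : ℕ), r ∈ Sr →
      (∑ h ∈ (Finset.Ico 1 ⌈bigP D / r⌉₊).filter (fun h => D₂ / Nat.gcd D₂ r ∣ h),
        (D₂ : ℝ) / ((Nat.totient (h * r) : ℝ) * h * Real.sqrt r) *
          ∑ θ ∈ finsetOf {θ : DirichletCharacter ℂ r | θ.IsPrimitive ∧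
              changeLevel (dvd_mul_left r D) θ ≠ changeLevel (dvd_mul_right D r) χ},
            ‖∑' l : ℕ, if Nat.Coprime l h then
                κs (D₁ * d * l) * θ (l : ZMod r) *
                  ∑ p ∈ primeWindow D, χ (p : ZMod D) * θ⁻¹ (p : ZMod r) * wt D β p *
                    DeltaW D ((l : ℝ) / ((p : ℝ) * h * r)) else 0‖) ≤
        M * (d.divisors.card : ℝ) ^ 4 * (3 * L ^ 9) := by
    intro d r hr
    have hr2 : 2 ≤ r := (Finset.mem_Icc.mp (Finset.mem_filter.mp hr).1).1
    have hr0 : (0 : ℝ) < r := by exact_mod_cast (show 0 < r by omega)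
    set Hs := (Finset.Ico 1 ⌈bigP D / r⌉₊).filter (fun h => D₂ / Nat.gcd D₂ r ∣ h) with hHs
    calc (∑ h ∈ Hs, (D₂ : ℝ) / ((Nat.totient (h * r) : ℝ) * h * Real.sqrt r) * _)
        ≤ ∑ h ∈ Hs, (D₂ : ℝ) / ((Nat.totient (h * r) : ℝ) * h * Real.sqrt r) * ((r : ℝ) * BND d h r) := by
          refine Finset.sum_le_sum fun h hh => ?_
          exact mul_le_mul_of_nonneg_left (hθsum d r h hr hh) (by positivity)
      _ ≤ ∑ h ∈ Hs, M * (d.divisors.card : ℝ) ^ 4 * (1 / (h : ℝ)) :=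
          Finset.sum_le_sum fun h hh => hterm d r h hr hh
      _ ≤ ∑ h ∈ Finset.Ico 1 ⌈bigP D / r⌉₊, M * (d.divisors.card : ℝ) ^ 4 * (1 / (h : ℝ)) :=
          Finset.sum_le_sum_of_subset_of_nonneg (Finset.filter_subset _ _)
            (fun _ _ _ => by positivity)
      _ = M * (d.divisors.card : ℝ) ^ 4 * ∑ h ∈ Finset.Ico 1 ⌈bigP D / r⌉₊, (1 / (h : ℝ)) := by
          rw [Finset.mul_sum]
      _ ≤ M * (d.divisors.card : ℝ) ^ 4 * (3 * L ^ 9) := by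
          refine mul_le_mul_of_nonneg_left ?_ (by positivity)
          refine (sum_Ico_one_div_le₂ _).trans ?_
          -- `⌈P/r⌉ ≤ P/2 + 1 ≤ 2P`, `log(2P) ≤ 1 + 𝓛⁹`
          have hceil : (⌈bigP D / r⌉₊ : ℝ) ≤ 2 * bigP D := by
            have h1 : (⌈bigP D / r⌉₊ : ℝ) < bigP D / r + 1 := Nat.ceil_lt_add_one (by positivity)
            have h2 : bigP D / r ≤ bigP D := div_le_self hP0.le (by exact_mod_cast (show 1 ≤ r by omega))
            linarith
          rcases Nat.eq_zero_or_pos ⌈bigP D / r⌉₊ with h0 | hpos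
          · rw [h0]; simp; nlinarith
          · have hlog : Real.log (⌈bigP D / r⌉₊ : ℝ) ≤ Real.log 2 + L ^ 9 := by
              calc Real.log (⌈bigP D / r⌉₊ : ℝ) ≤ Real.log (2 * bigP D) :=
                    Real.log_le_log (by exact_mod_cast hpos) hceil
                _ = Real.log 2 + L ^ 9 := by rw [Real.log_mul (by norm_num) hP0.ne', hlogP]
            linarith
  -- Step 5: the sum over `r ∈ Sr` (at most `D³` terms)
  have hcardSr : (Sr.card : ℝ) ≤ (D : ℝ) ^ 3 := by
    have h1 : Sr ⊆ Finset.range (D ^ 3) := fun r hr => by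
      rw [Finset.mem_range]; exact (Finset.mem_filter.mp hr).2
    have h2 := Finset.card_le_card h1
    rw [Finset.card_range] at h2
    exact_mod_cast h2
  have hsumr : ∀ d : ℕ,
      (∑ r ∈ Sr, ∑ h ∈ (Finset.Ico 1 ⌈bigP D / r⌉₊).filter (fun h => D₂ / Nat.gcd D₂ r ∣ h),
        (D₂ : ℝ) / ((Nat.totient (h * r) : ℝ) * h * Real.sqrt r) *
          ∑ θ ∈ finsetOf {θ : DirichletCharacter ℂ r | θ.IsPrimitive ∧
              changeLevel (dvd_mul_left r D) θ ≠ changeLevel (dvd_mul_right D r) χ},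
            ‖∑' l : ℕ, if Nat.Coprime l h then
                κs (D₁ * d * l) * θ (l : ZMod r) *
                  ∑ p ∈ primeWindow D, χ (p : ZMod D) * θ⁻¹ (p : ZMod r) * wt D β p *
                    DeltaW D ((l : ℝ) / ((p : ℝ) * h * r)) else 0‖) ≤
        (D : ℝ) ^ 3 * (M * (d.divisors.card : ℝ) ^ 4 * (3 * L ^ 9)) := by
    intro d
    have h1 := Finset.sum_le_card_nsmul Sr _ (M * (d.divisors.card : ℝ) ^ 4 * (3 * L ^ 9))
      (fun r hr => hsumh d r hr)
    rw [nsmul_eq_mul] at h1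
    exact h1.trans (mul_le_mul_of_nonneg_right hcardSr (by positivity))
  -- Step 6: the sum over `d`
  have hlog2P4 : 1 + Real.log (⌊2 * P4 D⌋₊ : ℝ) ≤ 2 * L ^ 9 := by
    have hP4' : 2 * P4 D ≤ bigP D := hP4 D (by omega)
    rcases Nat.eq_zero_or_pos ⌊2 * P4 D⌋₊ with h0 | hpos
    · rw [h0]; simp; linarith
    · have hT0 : 0 < bigT D := Real.exp_pos _
      have ht00 : 0 ≤ t0 D := by rw [t0]; exact pow_nonneg (by linarith) _
      have h2P4 : 0 ≤ 2 * P4 D := by rw [P4]; positivity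
      have hfl : (⌊2 * P4 D⌋₊ : ℝ) ≤ bigP D := (Nat.floor_le h2P4).trans hP4'
      have : Real.log (⌊2 * P4 D⌋₊ : ℝ) ≤ L ^ 9 := by
        rw [← hlogP]; exact Real.log_le_log (by exact_mod_cast hpos) hfl
      linarith
  have hsumd : ∑ d ∈ Finset.Icc 1 ⌊2 * P4 D⌋₊, (d : ℝ)⁻¹ *
      ((D : ℝ) ^ 3 * (M * (d.divisors.card : ℝ) ^ 4 * (3 * L ^ 9))) ≤
      (D : ℝ) ^ 3 * M * (3 * L ^ 9) * (2 * L ^ 9) ^ 16 := by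
    have e1 : ∑ d ∈ Finset.Icc 1 ⌊2 * P4 D⌋₊, (d : ℝ)⁻¹ *
        ((D : ℝ) ^ 3 * (M * (d.divisors.card : ℝ) ^ 4 * (3 * L ^ 9))) =
        (D : ℝ) ^ 3 * M * (3 * L ^ 9) *
          ∑ d ∈ Finset.Icc 1 ⌊2 * P4 D⌋₊, (d.divisors.card : ℝ) ^ 4 / d := by
      rw [Finset.mul_sum]
      exact Finset.sum_congr rfl fun d _ => by rw [div_eq_mul_inv]; ring
    rw [e1]
    refine mul_le_mul_of_nonneg_left ?_ (by positivity)
    calc ∑ d ∈ Finset.Icc 1 ⌊2 * P4 D⌋₊, (d.divisors.card : ℝ) ^ 4 / d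
        ≤ (1 + Real.log (⌊2 * P4 D⌋₊ : ℝ)) ^ (2 ^ 4) := sum_card_divisors_pow_div_le_log_pow 4 _
      _ = (1 + Real.log (⌊2 * P4 D⌋₊ : ℝ)) ^ 16 := by norm_num
      _ ≤ (2 * L ^ 9) ^ 16 := by
          refine pow_le_pow_left₀ ?_ hlog2P4 16
          have : 0 ≤ Real.log (⌊2 * P4 D⌋₊ : ℝ) := Real.log_natCast_nonneg _
          linarith
  -- Step 7: assembling and absorbing the powers of `𝓛`
  have hfinal : (D : ℝ) ^ 3 * M * (3 * L ^ 9) * (2 * L ^ 9) ^ 16 ≤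
      1 * bigP D ^ 2 * (D : ℝ) ^ (-(1 : ℝ)) := by
    have habs' : 12 * 2 ^ 16 * C₀ * L ^ 171 ≤ D := habs D (by omega)
    have e13 : (D : ℝ) ^ (-((13 : ℕ) : ℝ)) = ((D : ℝ) ^ 13)⁻¹ := by
      rw [Real.rpow_neg hD0.le, Real.rpow_natCast]
    have e1 : (D : ℝ) ^ (-(1 : ℝ)) = ((D : ℝ))⁻¹ := Real.rpow_neg_one _
    have eLHS : (D : ℝ) ^ 3 * M * (3 * L ^ 9) * (2 * L ^ 9) ^ 16 =
        (12 * 2 ^ 16 * C₀ * L ^ 171) * P ^ 2 * ((D : ℝ) ^ 11 * ((D : ℝ) ^ 13)⁻¹) := by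
      simp only [hM]; rw [e13]; ring
    have e11 : (D : ℝ) ^ 11 * ((D : ℝ) ^ 13)⁻¹ = ((D : ℝ) ^ 2)⁻¹ := by
      field_simp
    rw [eLHS, e11, e1, one_mul]
    -- goal: `K 𝓛¹⁷¹ · P² · (D²)⁻¹ ≤ P² · D⁻¹`
    have hD2 : (0 : ℝ) < (D : ℝ) ^ 2 := by positivity
    rw [show bigP D ^ 2 * ((D : ℝ))⁻¹ = (bigP D ^ 2 * D) * ((D : ℝ) ^ 2)⁻¹ by
      field_simp]
    refine mul_le_mul_of_nonneg_right ?_ (by positivity)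
    calc 12 * 2 ^ 16 * C₀ * L ^ 171 * P ^ 2 = P ^ 2 * (12 * 2 ^ 16 * C₀ * L ^ 171) := by ring
      _ ≤ P ^ 2 * D := mul_le_mul_of_nonneg_left habs' (by positivity)
      _ = bigP D ^ 2 * D := by rw [hPdef]
  -- the chain
  calc ∑ d ∈ Finset.Icc 1 ⌊2 * P4 D⌋₊, (d : ℝ)⁻¹ * ∑ r ∈ Sr,
        ∑ h ∈ (Finset.Ico 1 ⌈bigP D / r⌉₊).filter (fun h => D₂ / Nat.gcd D₂ r ∣ h),
          (D₂ : ℝ) / ((Nat.totient (h * r) : ℝ) * h * Real.sqrt r) *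
            ∑ θ ∈ finsetOf {θ : DirichletCharacter ℂ r | θ.IsPrimitive ∧
                changeLevel (dvd_mul_left r D) θ ≠ changeLevel (dvd_mul_right D r) χ},
              ‖∑' l : ℕ, if Nat.Coprime l h then
                  κs (D₁ * d * l) * θ (l : ZMod r) *
                    ∑ p ∈ primeWindow D, χ (p : ZMod D) * θ⁻¹ (p : ZMod r) * wt D β p *
                      DeltaW D ((l : ℝ) / ((p : ℝ) * h * r)) else 0‖
      ≤ ∑ d ∈ Finset.Icc 1 ⌊2 * P4 D⌋₊, (d : ℝ)⁻¹ *
          ((D : ℝ) ^ 3 * (M * (d.divisors.card : ℝ) ^ 4 * (3 * L ^ 9))) := by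
        refine Finset.sum_le_sum fun d _ => ?_
        exact mul_le_mul_of_nonneg_left (hsumr d) (by positivity)
    _ ≤ (D : ℝ) ^ 3 * M * (3 * L ^ 9) * (2 * L ^ 9) ^ 16 := hsumd
    _ ≤ 1 * bigP D ^ 2 * (D : ℝ) ^ (-(1 : ℝ)) := hfinal

/-! ## (14.6) from the large-sieve leg alone -/

/-- **(14.6)ᵂ ⇐ the remaining leg.** With the small-conductor leg proved (`leg1₂_holds`), the weighted
(14.6) in the shape of the hypothesis `h146` of `prop141_of_parts` follows from the large-conductor
leg at the modulus `D₂k` (`D³ ≤ r ≤ 2D₂P₄`: "the Mellin transform, Lemma 5.4 (i) and the large sieve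
inequality", p. 79) ALONE — by `eq146W_of_legs`. [cite: Zhang2022LandauSiegel, §14 (14.6) pp.78–79, tex L3915, L3960–L3969] -/
theorem eq146W_of_leg2₂
    (hleg2 : ∀ B : ℝ, ∃ c : ℝ, 0 < c ∧ ∃ C : ℝ, ForAllLarge fun D _ χ => AssumptionA D χ →
      ∀ β : ℂ, ‖β‖ < 5 * alpha D → ∀ κs as : ℕ → ℂ, Eq141 B κs → Eq142 D B as →
        ∀ D₁ D₂ : ℕ, D₁ * D₂ = D → 1 < D₁ →
          ∑ d ∈ Finset.Icc 1 ⌊2 * P4 D⌋₊, (d : ℝ)⁻¹ *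
            ∑ r ∈ (Finset.Icc 2 ⌊2 * (D₂ : ℝ) * P4 D⌋₊).filter (fun r => ¬ r < D ^ 3),
              ∑ h ∈ (Finset.Ico 1 ⌈bigP D / r⌉₊).filter (fun h => D₂ / Nat.gcd D₂ r ∣ h),
                (D₂ : ℝ) / ((Nat.totient (h * r) : ℝ) * h * Real.sqrt r) *
                  ∑ θ' ∈ finsetOf {θ' : DirichletCharacter ℂ r | θ'.IsPrimitive ∧
                      changeLevel (dvd_mul_left r D) θ' ≠ changeLevel (dvd_mul_right D r) χ},
                    ‖∑' l : ℕ, if Nat.Coprime l h then κs (D₁ * d * l) * θ' (l : ZMod r) *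
                        ∑ p ∈ primeWindow D, χ (p : ZMod D) * θ'⁻¹ (p : ZMod r) * wt D β p *
                        DeltaW D ((l : ℝ) / ((p : ℝ) * h * r)) else 0‖
          ≤ C * bigP D ^ 2 * (D : ℝ) ^ (-c)) :
    ∀ B : ℝ, ∃ c : ℝ, 0 < c ∧ ∃ C : ℝ, ForAllLarge fun D _ χ => AssumptionA D χ →
      ∀ β : ℂ, ‖β‖ < 5 * alpha D → ∀ κs as : ℕ → ℂ, Eq141 B κs → Eq142 D B as →
        ∀ D₁ D₂ : ℕ, D₁ * D₂ = D → 1 < D₁ →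
          ‖∑ p ∈ primeWindow D, χ (p : ZMod D) * wt D β p * calS D D₁ D₂ p κs as‖
            ≤ C * bigP D ^ 2 * (D : ℝ) ^ (1 / 2 - c) :=
  eq146W_of_legs leg1₂_holds hleg2

/-- **(14.6) as printed (`Typed.Sec14.Eq146`) ⇐ the remaining leg**, by `eq146_of_legsW` with the
small-conductor leg supplied by `leg1₂_holds`. [cite: Zhang2022LandauSiegel, §14 (14.6) p.78, tex L3915] -/
theorem eq146_of_leg2₂
    (hleg2 : ∀ B : ℝ, ∃ c : ℝ, 0 < c ∧ ∃ C : ℝ, ForAllLarge fun D _ χ => AssumptionA D χ →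
      ∀ β : ℂ, ‖β‖ < 5 * alpha D → ∀ κs as : ℕ → ℂ, Eq141 B κs → Eq142 D B as →
        ∀ D₁ D₂ : ℕ, D₁ * D₂ = D → 1 < D₁ →
          ∑ d ∈ Finset.Icc 1 ⌊2 * P4 D⌋₊, (d : ℝ)⁻¹ *
            ∑ r ∈ (Finset.Icc 2 ⌊2 * (D₂ : ℝ) * P4 D⌋₊).filter (fun r => ¬ r < D ^ 3),
              ∑ h ∈ (Finset.Ico 1 ⌈bigP D / r⌉₊).filter (fun h => D₂ / Nat.gcd D₂ r ∣ h),
                (D₂ : ℝ) / ((Nat.totient (h * r) : ℝ) * h * Real.sqrt r) *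
                  ∑ θ' ∈ finsetOf {θ' : DirichletCharacter ℂ r | θ'.IsPrimitive ∧
                      changeLevel (dvd_mul_left r D) θ' ≠ changeLevel (dvd_mul_right D r) χ},
                    ‖∑' l : ℕ, if Nat.Coprime l h then κs (D₁ * d * l) * θ' (l : ZMod r) *
                        ∑ p ∈ primeWindow D, χ (p : ZMod D) * θ'⁻¹ (p : ZMod r) * wt D β p *
                        DeltaW D ((l : ℝ) / ((p : ℝ) * h * r)) else 0‖
          ≤ C * bigP D ^ 2 * (D : ℝ) ^ (-c)) :
    Eq146 :=
  eq146_of_legsW leg1₂_holds hleg2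

end Literature.NumberTheory.LFunctions.Zhang2022.Typed.Sec14
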